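import Mathlib
import HarnessLib
import Literature.Analysis.Complex.VerticalSinSummation
import Summits.KontsevichZagierPeriods.Zeta5Search.Denom.TwoTaleP15Forms

/-!
# P15 two-tale forms — the DECAY input `Decay c`, decomposed into typed sub-inputs

HONEST FRAMING: systematic search; no irrationality claim unless certified.  This file proves NO analytic
estimate and claims NO measure of `ζ(2)`.  It fixes, in the kernel, the SHAPE of an elementary proof of the
decay input `TwoTaleP15Forms.Decay c` of `TwoTaleP15Forms.zetaTwo_exponent_le_of_inputs` (Zudilin 2014,
arXiv:1310.1526, Prop. 1 eq. (P4) and Lemma 6, at the point P15: `a = (13n+1, 11n+1, 9n+1, 15n+1)`,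
`b = (1, 2n+1, 4n+1, 26n+2)`, `a₂* = 11n+1`, `d = 16n−1`), namely the VERTICAL-LINE MODULUS BOUND on half-integer
lines (design note `families/denom/P15KERNEL.md` §6; independently `families/measure/FAMILY.md` §10.2):

* objects: `kernelSq t = (π / sin πt)²`; `ratRC n t` = the rational function `R(t)` of Prop. 1 at P15 with a
  complex argument (`ratRC_intCast`: it is `TwoTaleP15Forms.ratR` at integers); the line integral
  `lineIntegral n x = (1/2π) ∫_ℝ kernelSq (x+iy) · ratRC n (x − a₂* + iy) dy`
  (`= (1/2πi) ∫_{x−i∞}^{x+i∞} (π/sin πt)² R(t − a₂*) dt`, `t = x + iy`);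
* PROVED: `kernelSq (t+1) = kernelSq t`; on half-integer lines `‖kernelSq (m+½+iy)‖ = π²/cosh²(πy)`
  (`norm_kernelSq_half`), hence `‖lineIntegral n (m+½)‖ ≤ (π/2) ∫_ℝ ‖ratRC n (m+½−a₂*+iy)‖ / cosh²(πy) dy`
  (`norm_lineIntegral_half_le`) — `|∫| ≤ ∫|·|`, nothing more;
* NAMED sub-inputs (NOT proved here; each a standard statement): `LineRep` — Prop. 1 (P4)–(P5):
  `qₙ ζ(2) − pₙ = −lineIntegral n ½` (Zudilin's Lemmas 1–2 = Barnes's first lemma and the `cot` contour shift, plus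
  the partial-fraction decomposition (P1)–(P2); tree: `Zudilin2014.FirstTaleScaling.R_eq_polyP_add_polar`);
  `StripShift` — `lineIntegral n (m+½) = lineIntegral n ½` for `m ≤ 9n` (the integrand is holomorphic on
  `0 < Re t < 9n+1` because `R(t − a₂*)` vanishes to order ≥ 2 at `t = 1, …, 9n`; rectangle theorem + horizontal decay
  `e^{−2π|y|}`);
* PROVED reductions: `decay_of_lineBound : LineRep → StripShift → (line bound on the lines x = xₙ + ½, xₙ ≤ 9n)
  → Decay c` and the loose-constant corollary `zetaTwo_exponent_le_loose : Inclusion → Decay 29.10 → CoeffRate C₁ →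
  0 < C₁ ≤ 42.04 → ExponentLE (ζ(2)) 5.0523` requested by fam-measure (margins for certified numerics; the sharp
  constants `29.10787 / 42.033616 → 5.0496` are `TwoTaleP15Forms.zetaTwo_exponent_le_of_inputs`).

What remains for `Decay c` (any `c < C₀ = 29.10787127…`) after this file: `LineRep`, `StripShift`, and the
line bound `(π/2)∫‖R‖ sech² ≤ e^{−cn}` on `xₙ = ⌊ξ* n⌋`, `ξ* = 5.19913…` (Stirling / Riemann sums + a one-variable
certificate `max_η h(ξ*, η) ≤ −c`; the min–max equals `−C₀` exactly — P15KERNEL.md §6.2).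
References: W. Zudilin, arXiv:1310.1526 [Zudilin2014ZetaTwo] Prop. 1, Lemmas 1, 2, 6; M. Hata, Acta Arith. 63 (1993).
-/

noncomputable section

open Filter Topology Finset MeasureTheory
open Literature.NumberTheory.Transcendental
open Summit.KontsevichZagierPeriods.Zeta5Search
open Summit.KontsevichZagierPeriods.Zeta5Search.Denom.TwoTaleP15Saving
open Summit.KontsevichZagierPeriods.Zeta5Search.Denom.TwoTaleP15Forms

namespace Summit.KontsevichZagierPeriods.Zeta5Search.Denom.TwoTaleP15Decay

/-! ### Objects -/

/-- The squared Barnes kernel `(π / sin πt)²`. -/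
def kernelSq (t : ℂ) : ℂ := ((Real.pi : ℂ) / Complex.sin (Real.pi * t)) ^ 2

/-- The rational function `R(t)` of [Zudilin2014ZetaTwo, Prop. 1] at P15, complex argument:
`∏_{j≤3} [∏_{i=b_j}^{a_j−1} (t+i)/(a_j−b_j)!] · (b₄−a₄−1)!/∏_{i=a₄}^{b₄−1} (t+i)` (same shape as `ratR`). -/
def ratRC (n : ℕ) (t : ℂ) : ℂ :=
  (∏ i ∈ Ico 1 (13 * n + 1), (t + i)) / (Nat.factorial (13 * n) : ℂ) *
    ((∏ i ∈ Ico (2 * n + 1) (11 * n + 1), (t + i)) / (Nat.factorial (9 * n) : ℂ)) *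
    ((∏ i ∈ Ico (4 * n + 1) (9 * n + 1), (t + i)) / (Nat.factorial (5 * n) : ℂ)) *
    ((Nat.factorial (11 * n) : ℂ) / ∏ i ∈ Ico (15 * n + 1) (26 * n + 2), (t + i))

/-- The vertical-line integral `(1/2π) ∫_ℝ (π/sin π(x+iy))² R(x − a₂* + iy) dy`, `a₂* = 11n+1` — i.e.
`(1/2πi) ∫_{x−i∞}^{x+i∞} (π/sin πt)² R(t − a₂*) dt` with `t = x + iy`, `dt = i dy`. -/
def lineIntegral (n : ℕ) (x : ℝ) : ℂ :=
  (1 / (2 * Real.pi) : ℂ) *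
    ∫ y : ℝ, kernelSq ((x : ℂ) + (y : ℂ) * Complex.I) * ratRC n ((x : ℂ) - (11 * n + 1) + (y : ℂ) * Complex.I)

/-- `ratRC` at an integer is `ratR`. -/
theorem ratRC_intCast (n : ℕ) (m : ℤ) : ratRC n (m : ℂ) = ((ratR n m : ℚ) : ℂ) := by
  simp only [ratRC, ratR]
  push_cast
  rfl

/-- Periodicity: `(π/sin π(t+1))² = (π/sin πt)²`. -/
theorem kernelSq_add_one (t : ℂ) : kernelSq (t + 1) = kernelSq t := by
  simp only [kernelSq, mul_add, mul_one, Complex.sin_add_pi, div_neg, neg_sq]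

/-! ### The kernel on half-integer lines -/

/-- `|sin π(m + ½ + iy)|² = cosh²(πy)` for `m ∈ ℕ`. -/
theorem norm_sin_sq_half (m : ℕ) (y : ℝ) :
    ‖Complex.sin (Real.pi * ((((m : ℝ) + 1 / 2 : ℝ) : ℂ) + (y : ℂ) * Complex.I))‖ ^ 2 =
      Real.cosh (Real.pi * y) ^ 2 := by
  rw [Literature.Analysis.Complex.norm_sin_sq_eq]
  have hre : ((Real.pi : ℂ) * ((((m : ℝ) + 1 / 2 : ℝ) : ℂ) + (y : ℂ) * Complex.I)).re =
      Real.pi * ((m : ℝ) + 1 / 2) := by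
    simp [Complex.mul_re]
  have him : ((Real.pi : ℂ) * ((((m : ℝ) + 1 / 2 : ℝ) : ℂ) + (y : ℂ) * Complex.I)).im = Real.pi * y := by
    simp [Complex.mul_im]
  rw [hre, him]
  have hc : Real.cos (Real.pi * ((m : ℝ) + 1 / 2)) = 0 :=
    Real.cos_eq_zero_iff.mpr ⟨m, by push_cast; ring⟩
  have hs : Real.sin (Real.pi * ((m : ℝ) + 1 / 2)) ^ 2 = 1 := by
    nlinarith [Real.sin_sq_add_cos_sq (Real.pi * ((m : ℝ) + 1 / 2)), hc]
  rw [hs, Real.cosh_sq]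
  ring

/-- **`‖(π / sin π(m + ½ + iy))²‖ = π² / cosh²(πy)`** on the half-integer lines. -/
theorem norm_kernelSq_half (m : ℕ) (y : ℝ) :
    ‖kernelSq ((((m : ℝ) + 1 / 2 : ℝ) : ℂ) + (y : ℂ) * Complex.I)‖ = Real.pi ^ 2 / Real.cosh (Real.pi * y) ^ 2 := by
  rw [kernelSq, norm_pow, norm_div, Complex.norm_real, Real.norm_eq_abs, abs_of_pos Real.pi_pos, div_pow,
    norm_sin_sq_half]

/-- **Vertical-line modulus bound** (`|∫| ≤ ∫|·|` and the kernel identity; no estimate of `R`):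
`‖lineIntegral n (m+½)‖ ≤ (π/2) ∫_ℝ ‖R(m + ½ − a₂* + iy)‖ / cosh²(πy) dy`. -/
theorem norm_lineIntegral_half_le (n m : ℕ) :
    ‖lineIntegral n ((m : ℝ) + 1 / 2)‖ ≤ Real.pi / 2 *
      ∫ y : ℝ, ‖ratRC n ((((m : ℝ) + 1 / 2 : ℝ) : ℂ) - (11 * n + 1) + (y : ℂ) * Complex.I)‖ /
        Real.cosh (Real.pi * y) ^ 2 := by
  unfold lineIntegral
  rw [norm_mul]
  have hnorm : ‖(1 / (2 * Real.pi) : ℂ)‖ = 1 / (2 * Real.pi) := by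
    rw [show (1 / (2 * Real.pi) : ℂ) = ((1 / (2 * Real.pi) : ℝ) : ℂ) by push_cast; ring, Complex.norm_real,
      Real.norm_eq_abs, abs_of_pos (by positivity)]
  rw [hnorm]
  have hint := norm_integral_le_integral_norm (μ := volume)
    (fun y : ℝ => kernelSq ((((m : ℝ) + 1 / 2 : ℝ) : ℂ) + (y : ℂ) * Complex.I) *
      ratRC n ((((m : ℝ) + 1 / 2 : ℝ) : ℂ) - (11 * n + 1) + (y : ℂ) * Complex.I))
  have heq : (fun y : ℝ => ‖kernelSq ((((m : ℝ) + 1 / 2 : ℝ) : ℂ) + (y : ℂ) * Complex.I) *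
      ratRC n ((((m : ℝ) + 1 / 2 : ℝ) : ℂ) - (11 * n + 1) + (y : ℂ) * Complex.I)‖) =
      fun y : ℝ => Real.pi ^ 2 * (‖ratRC n ((((m : ℝ) + 1 / 2 : ℝ) : ℂ) - (11 * n + 1) + (y : ℂ) * Complex.I)‖ /
        Real.cosh (Real.pi * y) ^ 2) := by
    funext y
    rw [norm_mul, norm_kernelSq_half]
    ring
  rw [heq, integral_const_mul] at hint
  calc 1 / (2 * Real.pi) * ‖∫ y : ℝ, kernelSq ((((m : ℝ) + 1 / 2 : ℝ) : ℂ) + (y : ℂ) * Complex.I) *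
          ratRC n ((((m : ℝ) + 1 / 2 : ℝ) : ℂ) - (11 * n + 1) + (y : ℂ) * Complex.I)‖
      ≤ 1 / (2 * Real.pi) * (Real.pi ^ 2 *
          ∫ y : ℝ, ‖ratRC n ((((m : ℝ) + 1 / 2 : ℝ) : ℂ) - (11 * n + 1) + (y : ℂ) * Complex.I)‖ /
            Real.cosh (Real.pi * y) ^ 2) := by gcongr
    _ = Real.pi / 2 * ∫ y : ℝ, ‖ratRC n ((((m : ℝ) + 1 / 2 : ℝ) : ℂ) - (11 * n + 1) + (y : ℂ) * Complex.I)‖ /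
          Real.cosh (Real.pi * y) ^ 2 := by
      rw [← mul_assoc]
      congr 1
      field_simp

/-! ### Named sub-inputs of `Decay` (NOT proved here) -/

/-- **SUB-INPUT (integral representation)** — [Zudilin2014ZetaTwo, Prop. 1, (P4)–(P5)] at P15:
`qₙ ζ(2) − pₙ = r_n = ((−1)^d/2πi) ∫_{½−i∞}^{½+i∞} (π/sin πt)² R(t − a₂*) dt = −lineIntegral n ½` (`d = 16n−1` odd).
Ingredients in print: Lemma 1 (Barnes's first lemma), Lemma 2 (`(π/sin πt)² dt = d(−π cot πt)` + rectangle residues),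
the partial fractions (P1)–(P2) (tree, for the general first tale: `Zudilin2014.R_eq_polyP_add_polar`). Not a tree theorem. -/
@[conjecture] def LineRep : Prop :=
  ∀ n : ℕ, 1 ≤ n → (formQ n : ℂ) * ((zetaValue 2 : ℝ) : ℂ) - ((formP n : ℚ) : ℂ) = -lineIntegral n (1 / 2)

/-- **SUB-INPUT (strip shift)**: the line may be moved to any half-integer abscissa `m + ½`, `m ≤ 9n`:
`(π/sin πt)² R(t − a₂*)` is holomorphic on `0 < Re t < 9n+1` (`R(t − a₂*)` vanishes to order ≥ 2 at `t = 1,…,9n`: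
factors `t − 11n − 1 + i`, `i ∈ [2n+1, 11n]` and `i ∈ [1, 13n]`), decays like `e^{−2π|Im t|}·|t|^{O(n)}`, and the
rectangle theorem applies. Standard; not a tree theorem. -/
@[conjecture] def StripShift : Prop :=
  ∀ n : ℕ, 1 ≤ n → ∀ m : ℕ, m ≤ 9 * n → lineIntegral n ((m : ℝ) + 1 / 2) = lineIntegral n (1 / 2)

/-! ### PROVED reductions -/

/-- **`Decay c` from the three pieces**: the integral representation, the strip shift, and a LINE BOUND on the
half-integer lines `x = xₙ + ½` (`xₙ ≤ 9n`; the design choice is `xₙ = ⌊ξ* n⌋`, `ξ* = 5.19913…`). -/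
theorem decay_of_lineBound {c : ℝ} (hRep : LineRep) (hShift : StripShift) (x : ℕ → ℕ)
    (hx : ∀ n, x n ≤ 9 * n)
    (hB : ∀ᶠ n : ℕ in atTop, Real.pi / 2 *
      ∫ y : ℝ, ‖ratRC n ((((x n : ℝ) + 1 / 2 : ℝ) : ℂ) - (11 * n + 1) + (y : ℂ) * Complex.I)‖ /
        Real.cosh (Real.pi * y) ^ 2 ≤ Real.exp (-(c * n))) :
    Decay c := by
  unfold Decay
  filter_upwards [hB, eventually_ge_atTop 1] with n hn h1
  have hc : (((formQ n : ℝ) * zetaValue 2 - (formP n : ℝ) : ℝ) : ℂ) = -lineIntegral n (1 / 2) := by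
    rw [← hRep n h1]
    push_cast
    ring
  calc |(formQ n : ℝ) * zetaValue 2 - (formP n : ℝ)|
      = ‖(((formQ n : ℝ) * zetaValue 2 - (formP n : ℝ) : ℝ) : ℂ)‖ := by
        rw [Complex.norm_real, Real.norm_eq_abs]
    _ = ‖lineIntegral n ((x n : ℝ) + 1 / 2)‖ := by rw [hc, norm_neg, hShift n h1 (x n) (hx n)]
    _ ≤ _ := norm_lineIntegral_half_le n (x n)
    _ ≤ Real.exp (-(c * n)) := hn

/-- **Loose-constant corollary** (margins for certified numerics, fam-measure FAMILY.md §10.2): with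
`c = 29.10 < C₀`, `0 < C₁ ≤ 42.04` (`C₁(P15) = 42.0336…`) and the certified `S ≥ 15.98084`:
`μ = 1 + (C₁ + 31 − S)/(c − 31 + S) ≤ 5.0523`.  An IMPLICATION ONLY — none of the inputs is a tree theorem. -/
theorem zetaTwo_exponent_le_loose {C₁ : ℝ} (hI : Inclusion) (hD : Decay 29.10) (hC : CoeffRate C₁)
    (hC₀ : 0 < C₁) (hC₁ : C₁ ≤ 42.04) : ExponentLE (zetaValue 2) 5.0523 := by
  have hS := savingRate_bounds
  have h := exponentLE_of_inputs hI hD hC (by linarith [hS.1]) hC₀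
  have hden : 0 < 29.10 - (31 - savingRate) := by linarith [hS.1]
  have hle : 1 + (C₁ + (31 - savingRate)) / (29.10 - (31 - savingRate)) ≤ 5.0523 := by
    have h1 : (C₁ + (31 - savingRate)) / (29.10 - (31 - savingRate)) ≤ 4.0523 := by
      rw [div_le_iff₀ hden]
      linarith [hS.1]
    linarith
  exact h.mono hle

/-- **End to end on the decay side**: `Inclusion`, the two named sub-inputs, a line bound with `c = 29.10`, and
`CoeffRate C₁` (`0 < C₁ ≤ 42.04`) give `ExponentLE (ζ(2)) 5.0523` — an implication; no input is certified. -/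
theorem zetaTwo_exponent_le_of_lineBound {C₁ : ℝ} (hI : Inclusion) (hRep : LineRep) (hShift : StripShift)
    (x : ℕ → ℕ) (hx : ∀ n, x n ≤ 9 * n)
    (hB : ∀ᶠ n : ℕ in atTop, Real.pi / 2 *
      ∫ y : ℝ, ‖ratRC n ((((x n : ℝ) + 1 / 2 : ℝ) : ℂ) - (11 * n + 1) + (y : ℂ) * Complex.I)‖ /
        Real.cosh (Real.pi * y) ^ 2 ≤ Real.exp (-(29.10 * n)))
    (hC : CoeffRate C₁) (hC₀ : 0 < C₁) (hC₁ : C₁ ≤ 42.04) : ExponentLE (zetaValue 2) 5.0523 :=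
  zetaTwo_exponent_le_loose hI (decay_of_lineBound hRep hShift x hx hB) hC hC₀ hC₁

end Summit.KontsevichZagierPeriods.Zeta5Search.Denom.TwoTaleP15Decay

end
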